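import Mathlib
import Literature.Analysis.SpecialFunctions.InvSinSqPartialFractions
import HarnessLib

/-!
# Beurling's extremal function `B(z)`

Topic `Literature/Analysis/Fourier`. Everything in this file is PROVED (definitions with bodies
and theorems; no named facts).

A. Beurling (late 1930s, unpublished; see J. D. Vaaler, *Some extremal functions in Fourier
analysis*, Bull. Amer. Math. Soc. 12 (1985) 183–216, §1 (1.1)–(1.5) and Theorem 8, and
H. L. Montgomery, *Ten lectures on the interface between analytic number theory and harmonic
analysis* (1994), Ch. 1 §2) introduced the entire function

  `B(z) = (sin πz / π)² ( Σ_{n ≥ 0} (z − n)⁻² − Σ_{n ≥ 1} (z + n)⁻² + 2/z )`,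

of exponential type `2π`, and proved `B(x) ≥ sgn(x)` for real `x` and `∫ (B(x) − sgn x) dx = 1`
(Vaaler 1985, Lemma 5 and Theorem 8 for `J = ½B'`… ; Montgomery 1994, Ch. 1, Lemma 5). It is the
building block of Selberg's majorant and minorant of the indicator of an interval
(`SelbergMajorants.lean`), used in the tree for the short-interval zero counts of
Balazard–de Roton, *Notes de lecture de l'article "Partial sums of the Möbius function" de
K. Soundararajan*, arXiv:0810.3587, Prop. 10.

## Design

* `Literature.Analysis.Fourier.sincPi z = sin(πz)/(πz)` (`= 1` at `0`), an entire function
  (`differentiable_sincPi`, via `dslope`), with `|sincPi z| ≤ e^π e^{π|Im z|}`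
  (`norm_sincPi_le`) and `|sincPi z| ≤ e^{π|Im z|}/(π|z|)` (`norm_sincPi_le_div`).
* Using `Σ_{n∈ℤ} (z−n)⁻² = π²/sin²(πz)`, Beurling's function equals
  `B(z) = 1 + 2 ( z·sincPi(z)² − Σ_{n ≥ 1} sincPi(z+n)² )`; we take THIS as the definition
  (`Literature.Analysis.Fourier.beurling`), which is manifestly entire (`differentiable_beurling`),
  and recover the relation with the two-sided series through the identity
  `Σ_{n∈ℤ} sincPi(z−n)² = 1` (`tsum_sincPi_sq_eq_one`, from the tree's real partial fraction
  expansion `Literature.Analysis.SpecialFunctions.hasSum_inv_sub_sq_add_inv_add_sq` and the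
  identity theorem).
* Main results: `beurling_add_beurling_neg` (`B(z) + B(−z) = 2 sincPi(z)²`),
  `one_le_beurlingReal` (`B(x) ≥ 1`, `x ≥ 0`), `neg_one_le_beurlingReal` (`B(x) ≥ −1`),
  `sign_le_beurlingReal` (**Beurling's inequality** `B(x) ≥ sgn x`),
  `beurlingReal_sub_sign_le` (`0 ≤ B(x) − sgn x ≤ min(2, 2/(π²x²))`),
  `integral_sinc_sq` (`∫ sinc(πx)² dx = 1`, by periodisation — no Dirichlet integral needed),
  `integral_beurlingReal_sub_sign` (**`∫ (B − sgn) = 1`**), and the growth bounds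
  `norm_beurling_sub_one_le` (`|B(z) − 1| ≤ 4e^{2π|Im z|}/|z|²`, `Re z ≥ 0`, `|z| ≥ 1`),
  `norm_beurling_add_one_le` (`Re z ≤ 0`), `norm_beurling_le` (`|B(z)| ≤ C e^{2π|Im z|}`).

## References

* [Vaaler1985] J. D. Vaaler, Some extremal functions in Fourier analysis, Bull. AMS 12 (1985),
  §1 and Thm. 8. [cite: Vaaler1985, Thm. 8]
* [Montgomery1994] H. L. Montgomery, Ten lectures on the interface between analytic number
  theory and harmonic analysis, CBMS 84 (1994), Ch. 1 §2.
* [BalazardDeRoton2008] M. Balazard, A. de Roton, Notes de lecture de l'article "Partial sums of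
  the Möbius function" de Kannan Soundararajan, arXiv:0810.3587, Prop. 10.
-/

noncomputable section

open Complex Filter Topology Set MeasureTheory Metric

open scoped Real

namespace Literature.Analysis.Fourier

/-! ## The normalised cardinal sine on `ℂ` -/

/-- `sincPi z = sin(πz)/(πz)`, with `sincPi 0 = 1`. [folklore] -/
def sincPi (z : ℂ) : ℂ := if z = 0 then 1 else Complex.sin (π * z) / (π * z)

/-- `sincPi 0 = 1`. [folklore] -/
@[simp] lemma sincPi_zero : sincPi 0 = 1 := by simp [sincPi]

/-- Off the origin `sincPi z = sin(πz)/(πz)`. [folklore] -/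
lemma sincPi_of_ne_zero {z : ℂ} (hz : z ≠ 0) : sincPi z = Complex.sin (π * z) / (π * z) := by
  simp [sincPi, hz]

/-- `sincPi` is even. [folklore] -/
lemma sincPi_neg (z : ℂ) : sincPi (-z) = sincPi z := by
  rcases eq_or_ne z 0 with rfl | hz
  · simp
  · rw [sincPi_of_ne_zero hz, sincPi_of_ne_zero (neg_ne_zero.2 hz), mul_neg, Complex.sin_neg,
      neg_div_neg_eq]

/-- On the real line `sincPi x = sinc(πx)` (Mathlib's `Real.sinc`). [folklore] -/
lemma sincPi_ofReal (x : ℝ) : sincPi x = (Real.sinc (π * x) : ℂ) := by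
  rcases eq_or_ne x 0 with rfl | hx
  · simp
  · have hπx : π * x ≠ 0 := mul_ne_zero Real.pi_ne_zero hx
    rw [sincPi_of_ne_zero (ofReal_ne_zero.2 hx), Real.sinc_of_ne_zero hπx]
    push_cast
    rfl

/-- `sincPi` vanishes at the non-zero integers. [folklore] -/
lemma sincPi_intCast {n : ℤ} (hn : n ≠ 0) : sincPi n = 0 := by
  rw [sincPi_of_ne_zero (by exact_mod_cast hn), mul_comm, Complex.sin_int_mul_pi, zero_div]

/-- `sin(π(z + n))² = sin(πz)²` for an integer shift. [folklore] -/
lemma sin_pi_mul_add_intCast_sq (z : ℂ) (n : ℤ) :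
    Complex.sin (π * (z + n)) ^ 2 = Complex.sin (π * z) ^ 2 := by
  have h : Complex.cos (2 * (π * (z + n))) = Complex.cos (2 * (π * z)) := by
    have : (2 * (π * (z + n)) : ℂ) = 2 * (π * z) + n * (2 * π) := by ring
    rw [this, Complex.cos_add_int_mul_two_pi]
  rw [Complex.sin_sq, Complex.sin_sq, Complex.cos_sq, Complex.cos_sq (π * z), h]

/-- `sincPi (z + n)² = sin(πz)²/(π²(z+n)²)` for an integer `n` with `z + n ≠ 0`. [folklore] -/
lemma sincPi_add_intCast_sq {z : ℂ} {n : ℤ} (h : z + n ≠ 0) :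
    sincPi (z + n) ^ 2 = Complex.sin (π * z) ^ 2 / (π ^ 2 * (z + n) ^ 2) := by
  rw [sincPi_of_ne_zero h, div_pow, sin_pi_mul_add_intCast_sq, mul_pow]

/-- `sincPi = dslope (sin(π·)) 0 / π`. [folklore] -/
lemma sincPi_eq_dslope (z : ℂ) :
    sincPi z = dslope (fun w : ℂ ↦ Complex.sin (π * w)) 0 z / π := by
  have hπ : (π : ℂ) ≠ 0 := ofReal_ne_zero.2 Real.pi_ne_zero
  rcases eq_or_ne z 0 with rfl | hz
  · rw [sincPi_zero, dslope_same]
    have h : HasDerivAt (fun w : ℂ ↦ Complex.sin (π * w)) (Complex.cos (π * 0) * (π * 1)) 0 :=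
      ((hasDerivAt_id (0 : ℂ)).const_mul (π : ℂ)).csin
    rw [h.deriv]
    simp [hπ]
  · rw [dslope_of_ne _ hz, slope_def_field, sincPi_of_ne_zero hz]
    simp only [mul_zero, Complex.sin_zero, sub_zero]
    rw [div_div, mul_comm z]

/-- `sincPi` is entire. [folklore] -/
theorem differentiable_sincPi : Differentiable ℂ sincPi := by
  have hf : Differentiable ℂ (fun w : ℂ ↦ Complex.sin (π * w)) :=
    Complex.differentiable_sin.comp (differentiable_id.const_mul _)
  have hd : Differentiable ℂ (dslope (fun w : ℂ ↦ Complex.sin (π * w)) 0) := by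
    intro z
    rcases eq_or_ne z 0 with rfl | hz
    · obtain ⟨p, hp⟩ := hf.analyticAt 0
      exact hp.has_fpower_series_dslope_fslope.analyticAt.differentiableAt
    · exact (differentiableAt_dslope_of_ne hz).2 (hf z)
  have : sincPi = fun z ↦ dslope (fun w : ℂ ↦ Complex.sin (π * w)) 0 z / π :=
    funext sincPi_eq_dslope
  rw [this]
  exact hd.div_const _

/-- `sincPi` is continuous. [folklore] -/
theorem continuous_sincPi : Continuous sincPi := differentiable_sincPi.continuous

/-- `|sin(πz)| ≤ e^{π|Im z|}`. [folklore] -/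
lemma norm_sin_pi_mul_le (z : ℂ) : ‖Complex.sin (π * z)‖ ≤ Real.exp (π * |z.im|) := by
  have him : |(π * z : ℂ).im| = π * |z.im| := by
    simp [Complex.mul_im, abs_mul, abs_of_pos Real.pi_pos]
  rw [← him]
  set w : ℂ := π * z
  rw [Complex.sin]
  have h1 : ‖Complex.exp (-w * I)‖ ≤ Real.exp |w.im| := by
    rw [Complex.norm_exp]
    exact Real.exp_le_exp.2 (by simp [le_abs_self])
  have h2 : ‖Complex.exp (w * I)‖ ≤ Real.exp |w.im| := by
    rw [Complex.norm_exp]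
    exact Real.exp_le_exp.2 (by simp [neg_le_abs])
  calc ‖(Complex.exp (-w * I) - Complex.exp (w * I)) * I / 2‖
      = ‖Complex.exp (-w * I) - Complex.exp (w * I)‖ / 2 := by simp
    _ ≤ (‖Complex.exp (-w * I)‖ + ‖Complex.exp (w * I)‖) / 2 := by
        gcongr; exact norm_sub_le _ _
    _ ≤ Real.exp |w.im| := by linarith

/-- `|sin(πz)|² ≤ e^{2π|Im z|}`. [folklore] -/
lemma norm_sin_pi_mul_sq_le (z : ℂ) :
    ‖Complex.sin (π * z)‖ ^ 2 ≤ Real.exp (2 * π * |z.im|) := by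
  have h := norm_sin_pi_mul_le z
  calc ‖Complex.sin (π * z)‖ ^ 2 ≤ Real.exp (π * |z.im|) ^ 2 := by
        gcongr
    _ = Real.exp (2 * π * |z.im|) := by rw [← Real.exp_nat_mul]; ring_nf

/-- `|sincPi z| ≤ e^{π|Im z|}/(π|z|)` for `z ≠ 0`. [folklore] -/
theorem norm_sincPi_le_div {z : ℂ} (hz : z ≠ 0) :
    ‖sincPi z‖ ≤ Real.exp (π * |z.im|) / (π * ‖z‖) := by
  rw [sincPi_of_ne_zero hz, norm_div]
  have h := norm_sin_pi_mul_le z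
  have hn : ‖(π : ℂ) * z‖ = π * ‖z‖ := by simp [abs_of_pos Real.pi_pos]
  rw [hn]
  gcongr

/-- On the unit sphere `|sincPi z| ≤ e^π`. [folklore] -/
lemma norm_sincPi_le_of_norm_eq_one {z : ℂ} (hz : ‖z‖ = 1) : ‖sincPi z‖ ≤ Real.exp π := by
  have hz0 : z ≠ 0 := by rintro rfl; simp at hz
  refine (norm_sincPi_le_div hz0).trans ?_
  rw [hz, mul_one]
  have him : |z.im| ≤ 1 := hz ▸ Complex.abs_im_le_norm z
  have h1 : Real.exp (π * |z.im|) ≤ Real.exp π :=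
    Real.exp_le_exp.2 (by nlinarith [Real.pi_pos, abs_nonneg z.im])
  have h3 : Real.exp π / π ≤ Real.exp π := by
    rw [div_le_iff₀ Real.pi_pos]
    nlinarith [Real.exp_pos π, Real.pi_gt_three]
  exact (div_le_div_of_nonneg_right h1 Real.pi_pos.le).trans h3

/-- **Global bound** `|sincPi z| ≤ e^π · e^{π|Im z|}` (maximum modulus on the unit disc, and
`norm_sincPi_le_div` outside). [folklore] -/
theorem norm_sincPi_le (z : ℂ) : ‖sincPi z‖ ≤ Real.exp π * Real.exp (π * |z.im|) := by
  have h1 : 1 ≤ Real.exp (π * |z.im|) := Real.one_le_exp (by positivity)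
  rcases le_or_gt ‖z‖ 1 with hz | hz
  · -- maximum modulus principle on the unit disc
    have hmax : ‖sincPi z‖ ≤ Real.exp π := by
      refine Complex.norm_le_of_forall_mem_frontier_norm_le (f := sincPi) (U := ball (0 : ℂ) 1)
        isBounded_ball differentiable_sincPi.diffContOnCl ?_ ?_
      · intro w hw
        rw [frontier_ball (0 : ℂ) one_ne_zero, mem_sphere_zero_iff_norm] at hw
        exact norm_sincPi_le_of_norm_eq_one hw
      · rw [closure_ball (0 : ℂ) one_ne_zero]
        exact mem_closedBall_zero_iff.2 hz
    calc ‖sincPi z‖ ≤ Real.exp π * 1 := by rw [mul_one]; exact hmax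
      _ ≤ Real.exp π * Real.exp (π * |z.im|) := by gcongr
  · have hz0 : z ≠ 0 := by rintro rfl; norm_num at hz
    calc ‖sincPi z‖ ≤ Real.exp (π * |z.im|) / (π * ‖z‖) := norm_sincPi_le_div hz0
      _ ≤ Real.exp (π * |z.im|) / 1 := by
          apply div_le_div_of_nonneg_left (Real.exp_pos _).le one_pos
          nlinarith [Real.pi_gt_three]
      _ ≤ Real.exp π * Real.exp (π * |z.im|) := by
          rw [div_one]
          exact le_mul_of_one_le_left (Real.exp_pos _).le (Real.one_le_exp Real.pi_pos.le)

/-- A uniform summable majorant for the shifted squares `sincPi(z + n + 1)²` on the disc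
`|z| ≤ R`: `|sincPi(z+n+1)²| ≤ K_R/(n+1)²`. [folklore] -/
theorem norm_sincPi_add_sq_le {R : ℝ} (hR : 0 ≤ R) {z : ℂ} (hz : ‖z‖ ≤ R) (n : ℕ) :
    ‖sincPi (z + (n + 1)) ^ 2‖ ≤
      Real.exp π ^ 2 * Real.exp (2 * π * R) * (4 * R ^ 2 + 4) / ((n : ℝ) + 1) ^ 2 := by
  have hn1 : (0 : ℝ) < (n : ℝ) + 1 := by positivity
  have him : |(z + (n + 1) : ℂ).im| ≤ R := by
    have : (z + (n + 1) : ℂ).im = z.im := by simp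
    rw [this]; exact (Complex.abs_im_le_norm z).trans hz
  have hexp : Real.exp (π * |(z + (n + 1) : ℂ).im|) ≤ Real.exp (π * R) :=
    Real.exp_le_exp.2 (mul_le_mul_of_nonneg_left him Real.pi_pos.le)
  have hexp2 : Real.exp (π * R) ^ 2 = Real.exp (2 * π * R) := by
    rw [← Real.exp_nat_mul]; ring_nf
  have he1 : 1 ≤ Real.exp π := Real.one_le_exp Real.pi_pos.le
  rw [norm_pow]
  rcases le_or_gt ((n : ℝ) + 1) (2 * R) with hsmall | hlarge
  · -- small `n`: the global bound
    have h1 : ‖sincPi (z + (n + 1))‖ ≤ Real.exp π * Real.exp (π * R) :=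
      (norm_sincPi_le _).trans (by gcongr)
    have h0 : 0 ≤ Real.exp π * Real.exp (π * R) := by positivity
    calc ‖sincPi (z + (n + 1))‖ ^ 2 ≤ (Real.exp π * Real.exp (π * R)) ^ 2 := by
          gcongr
      _ = Real.exp π ^ 2 * Real.exp (2 * π * R) * 1 := by rw [mul_pow, hexp2, mul_one]
      _ ≤ Real.exp π ^ 2 * Real.exp (2 * π * R) * ((4 * R ^ 2 + 4) / ((n : ℝ) + 1) ^ 2) := by
          gcongr
          rw [le_div_iff₀ (by positivity), one_mul]
          nlinarith
      _ = _ := by ring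
  · -- large `n`: `|z + n + 1| ≥ (n+1)/2`
    have hw : ((n : ℝ) + 1) / 2 ≤ ‖(z + (n + 1) : ℂ)‖ := by
      have h1 : ‖((n : ℂ) + 1)‖ = (n : ℝ) + 1 := by
        have : ((n : ℂ) + 1) = ((n + 1 : ℕ) : ℂ) := by push_cast; ring
        rw [this, Complex.norm_natCast]; push_cast; ring
      have h2 : ‖((n : ℂ) + 1)‖ - ‖z‖ ≤ ‖(z + (n + 1) : ℂ)‖ := by
        have := norm_sub_norm_le ((n : ℂ) + 1) (-z)
        rwa [norm_neg, sub_neg_eq_add, add_comm ((n : ℂ) + 1) z] at this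
      rw [h1] at h2
      linarith
    have hw0 : (z + (n + 1) : ℂ) ≠ 0 := by
      intro h; rw [h, norm_zero] at hw; linarith
    have h1 : ‖sincPi (z + (n + 1))‖ ≤ Real.exp (π * R) * (2 / (π * ((n : ℝ) + 1))) := by
      calc ‖sincPi (z + (n + 1))‖
          ≤ Real.exp (π * |(z + (n + 1) : ℂ).im|) / (π * ‖(z + (n + 1) : ℂ)‖) :=
            norm_sincPi_le_div hw0
        _ ≤ Real.exp (π * R) / (π * (((n : ℝ) + 1) / 2)) := by
            gcongr
        _ = Real.exp (π * R) * (2 / (π * ((n : ℝ) + 1))) := by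
            field_simp
    have h0 : 0 ≤ Real.exp (π * R) * (2 / (π * ((n : ℝ) + 1))) := by positivity
    calc ‖sincPi (z + (n + 1))‖ ^ 2 ≤ (Real.exp (π * R) * (2 / (π * ((n : ℝ) + 1)))) ^ 2 := by
          gcongr
      _ = Real.exp (2 * π * R) * (4 / π ^ 2) / ((n : ℝ) + 1) ^ 2 := by
          rw [mul_pow, hexp2]; field_simp; ring
      _ ≤ Real.exp π ^ 2 * Real.exp (2 * π * R) * (4 * R ^ 2 + 4) / ((n : ℝ) + 1) ^ 2 := by
          apply div_le_div_of_nonneg_right _ (by positivity)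
          have hπ2 : 4 / π ^ 2 ≤ 1 := by
            rw [div_le_one (by positivity)]; nlinarith [Real.pi_gt_three]
          calc Real.exp (2 * π * R) * (4 / π ^ 2) ≤ Real.exp (2 * π * R) * 1 := by gcongr
            _ ≤ Real.exp π ^ 2 * Real.exp (2 * π * R) * (4 * R ^ 2 + 4) := by
                rw [mul_one]
                have : 1 ≤ Real.exp π ^ 2 * (4 * R ^ 2 + 4) := by nlinarith [sq_nonneg R]
                nlinarith [Real.exp_pos (2 * π * R)]

/-- The series `Σ_{n≥0} sincPi(z+n+1)²` converges (absolutely). [folklore] -/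
theorem summable_sincPi_add_sq (z : ℂ) : Summable fun n : ℕ ↦ sincPi (z + (n + 1)) ^ 2 := by
  refine Summable.of_norm_bounded (g := fun n : ℕ ↦
    Real.exp π ^ 2 * Real.exp (2 * π * ‖z‖) * (4 * ‖z‖ ^ 2 + 4) / ((n : ℝ) + 1) ^ 2) ?_
    (fun n ↦ norm_sincPi_add_sq_le (norm_nonneg z) le_rfl n)
  simp_rw [div_eq_mul_inv]
  refine Summable.mul_left _ ?_
  have := (summable_nat_add_iff 1).2 (Real.summable_nat_pow_inv.2 one_lt_two)
  simpa [Nat.cast_add, Nat.cast_one] using this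

/-! ## Beurling's function -/

/-- **Beurling's function** `B(z) = 1 + 2(z·sincPi(z)² − Σ_{n≥1} sincPi(z+n)²)`; by
`Σ_{n∈ℤ}(z−n)⁻² = π²/sin²πz` this is Beurling's
`(sin πz/π)²(Σ_{n≥0}(z−n)⁻² − Σ_{n≥1}(z+n)⁻² + 2/z)` (Vaaler 1985, (1.1)–(1.5)).
[cite: Vaaler1985, §1 (1.1)–(1.5)] -/
def beurling (z : ℂ) : ℂ :=
  1 + 2 * (z * sincPi z ^ 2 - ∑' n : ℕ, sincPi (z + (n + 1)) ^ 2)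

/-- The shifted-square series is entire. [folklore] -/
theorem differentiable_tsum_sincPi_add_sq :
    Differentiable ℂ fun z : ℂ ↦ ∑' n : ℕ, sincPi (z + (n + 1)) ^ 2 := by
  intro z
  set R : ℝ := ‖z‖ + 1 with hR
  have hR0 : 0 ≤ R := by positivity
  have hopen : IsOpen (ball (0 : ℂ) R) := isOpen_ball
  have hdiff : DifferentiableOn ℂ (fun w : ℂ ↦ ∑' n : ℕ, sincPi (w + (n + 1)) ^ 2) (ball 0 R) := by
    refine differentiableOn_tsum_of_summable_norm (u := fun n : ℕ ↦
      Real.exp π ^ 2 * Real.exp (2 * π * R) * (4 * R ^ 2 + 4) / ((n : ℝ) + 1) ^ 2) ?_ ?_ hopen ?_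
    · simp_rw [div_eq_mul_inv]
      refine Summable.mul_left _ ?_
      have := (summable_nat_add_iff 1).2 (Real.summable_nat_pow_inv.2 one_lt_two)
      simpa [Nat.cast_add, Nat.cast_one] using this
    · intro n
      exact ((differentiable_sincPi.comp (differentiable_id.add_const _)).pow 2).differentiableOn
    · intro n w hw
      exact norm_sincPi_add_sq_le hR0 (le_of_lt (mem_ball_zero_iff.1 hw)) n
  exact (hdiff.differentiableAt (hopen.mem_nhds (mem_ball_zero_iff.2 (by rw [hR]; linarith))))

/-- **Beurling's function is entire.** [cite: Vaaler1985, §1] -/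
theorem differentiable_beurling : Differentiable ℂ beurling := by
  unfold beurling
  exact (differentiable_const _).add ((differentiable_const _).mul
    ((differentiable_id.mul (differentiable_sincPi.pow 2)).sub differentiable_tsum_sincPi_add_sq))

/-- `B` is continuous. [folklore] -/
theorem continuous_beurling : Continuous beurling := differentiable_beurling.continuous

/-! ## The periodisation identity `Σ_{n∈ℤ} sincPi(z+n)² = 1` -/

/-- `P(z) = sincPi(z)² + Σ_{n≥1} sincPi(z+n)² + Σ_{n≥1} sincPi(−z+n)²` (`= Σ_{n∈ℤ} sincPi(z+n)²`).
[folklore] -/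
def sincSqPeriodisation (z : ℂ) : ℂ :=
  sincPi z ^ 2 + ∑' n : ℕ, sincPi (z + (n + 1)) ^ 2 + ∑' n : ℕ, sincPi (-z + (n + 1)) ^ 2

/-- `P` is entire. [folklore] -/
theorem differentiable_sincSqPeriodisation : Differentiable ℂ sincSqPeriodisation := by
  have h3 : Differentiable ℂ fun z : ℂ ↦ ∑' n : ℕ, sincPi (-z + (n + 1)) ^ 2 :=
    differentiable_tsum_sincPi_add_sq.comp differentiable_neg
  unfold sincSqPeriodisation
  exact ((differentiable_sincPi.pow 2).add differentiable_tsum_sincPi_add_sq).add h3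

/-- `sinc(y)² ≤ 1/y²` (`y ≠ 0`) and `sinc(y)² ≤ 1`. [folklore] -/
lemma sinc_sq_le_inv_sq {y : ℝ} (hy : y ≠ 0) : Real.sinc y ^ 2 ≤ 1 / y ^ 2 := by
  rw [Real.sinc_of_ne_zero hy, div_pow]
  gcongr
  rw [sq_le_one_iff_abs_le_one]
  exact Real.abs_sin_le_one y

/-- `sinc(y)² ≤ 1`. [folklore] -/
lemma sinc_sq_le_one (y : ℝ) : Real.sinc y ^ 2 ≤ 1 := by
  rw [sq_le_one_iff_abs_le_one]
  exact Real.abs_sinc_le_one y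

/-- `sinc(π(x+n))² = sin²(πx)/(π²(x+n)²)` for a natural shift with `x + n ≠ 0`. [folklore] -/
lemma sinc_pi_mul_add_nat_sq {x : ℝ} {n : ℕ} (h : x + n ≠ 0) :
    Real.sinc (π * (x + n)) ^ 2 = Real.sin (π * x) ^ 2 / (π ^ 2 * (x + n) ^ 2) := by
  have hπ : π * (x + n) ≠ 0 := mul_ne_zero Real.pi_ne_zero h
  rw [Real.sinc_of_ne_zero hπ, div_pow, mul_pow]
  congr 1
  have : π * (x + n) = π * x + n * π := by ring
  rw [this, Real.sin_add_nat_mul_pi, mul_pow, ← pow_mul, Even.neg_one_pow ⟨n, by ring⟩, one_mul]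

/-- `sinc(π(−x+n))² = sin²(πx)/(π²(x−n)²)` for a natural shift with `x ≠ n`. [folklore] -/
lemma sinc_pi_mul_neg_add_nat_sq {x : ℝ} {n : ℕ} (h : -x + n ≠ 0) :
    Real.sinc (π * (-x + n)) ^ 2 = Real.sin (π * x) ^ 2 / (π ^ 2 * (x - n) ^ 2) := by
  rw [sinc_pi_mul_add_nat_sq h, mul_neg, Real.sin_neg, neg_sq]
  congr 2
  ring

/-- The complex shifted squares at a real point are real. [folklore] -/
lemma sincPi_ofReal_add_sq (x : ℝ) (n : ℕ) :
    sincPi ((x : ℂ) + (n + 1)) ^ 2 = ((Real.sinc (π * (x + (n + 1))) ^ 2 : ℝ) : ℂ) := by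
  have : ((x : ℂ) + (n + 1)) = ((x + (n + 1) : ℝ) : ℂ) := by push_cast; ring
  rw [this, sincPi_ofReal]; push_cast; ring

/-- The reflected complex shifted squares at a real point are real. [folklore] -/
lemma sincPi_neg_ofReal_add_sq (x : ℝ) (n : ℕ) :
    sincPi (-(x : ℂ) + (n + 1)) ^ 2 = ((Real.sinc (π * (-x + (n + 1))) ^ 2 : ℝ) : ℂ) := by
  have : (-(x : ℂ) + (n + 1)) = ((-x + (n + 1) : ℝ) : ℂ) := by push_cast; ring
  rw [this, sincPi_ofReal]; push_cast; ring

/-- The real shifted-square series converge. [folklore] -/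
theorem summable_sinc_sq_add (x : ℝ) : Summable fun n : ℕ ↦ Real.sinc (π * (x + (n + 1))) ^ 2 := by
  have h := summable_sincPi_add_sq (x : ℂ)
  simp_rw [sincPi_ofReal_add_sq] at h
  exact Complex.summable_ofReal.1 h

/-- The reflected real shifted-square series converges. [folklore] -/
theorem summable_sinc_sq_neg_add (x : ℝ) :
    Summable fun n : ℕ ↦ Real.sinc (π * (-x + (n + 1))) ^ 2 := by
  have := summable_sinc_sq_add (-x)
  simpa using this

/-- At a real point of `(0,1)` the periodisation is `1` (the partial fraction expansion of
`π²/sin²`). [cite: Vaaler1985, §1] -/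
theorem sincSqPeriodisation_eq_one_of_mem_Ioo {x : ℝ} (hx0 : 0 < x) (hx1 : x < 1) :
    sincSqPeriodisation x = 1 := by
  have hxZ : ∀ n : ℤ, x ≠ n := by
    intro n h
    have h0 : (0 : ℝ) < n := h ▸ hx0
    have h1 : (n : ℝ) < 1 := h ▸ hx1
    have h0' : (0 : ℤ) < n := by exact_mod_cast h0
    have h1' : n < 1 := by exact_mod_cast h1
    omega
  have hS := Literature.Analysis.SpecialFunctions.hasSum_inv_sub_sq_add_inv_add_sq hxZ
  have hs1 : Summable fun n : ℕ ↦ 1 / (x - (n + 1)) ^ 2 :=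
    Summable.of_nonneg_of_le (fun n ↦ by positivity) (fun n ↦ le_add_of_nonneg_right
      (by positivity)) hS.summable
  have hs2 : Summable fun n : ℕ ↦ 1 / (x + (n + 1)) ^ 2 :=
    Summable.of_nonneg_of_le (fun n ↦ by positivity) (fun n ↦ le_add_of_nonneg_left
      (by positivity)) hS.summable
  have hsin : Real.sin (π * x) ≠ 0 := by
    have := Real.sin_pos_of_pos_of_lt_pi (mul_pos Real.pi_pos hx0)
      (by nlinarith [Real.pi_pos])
    exact this.ne'
  have hx : x ≠ 0 := hx0.ne'
  -- rewrite everything in real terms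
  have hP : sincSqPeriodisation x = ((Real.sinc (π * x) ^ 2 +
      ∑' n : ℕ, Real.sinc (π * (x + (n + 1))) ^ 2 + ∑' n : ℕ, Real.sinc (π * (-x + (n + 1))) ^ 2 : ℝ) : ℂ) := by
    unfold sincSqPeriodisation
    simp_rw [sincPi_ofReal_add_sq, sincPi_neg_ofReal_add_sq]
    rw [← Complex.ofReal_tsum, ← Complex.ofReal_tsum, sincPi_ofReal]
    push_cast; ring
  rw [hP]
  have h1 : ∀ n : ℕ, Real.sinc (π * (x + (n + 1))) ^ 2 =
      Real.sin (π * x) ^ 2 / π ^ 2 * (1 / (x + (n + 1)) ^ 2) := by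
    intro n
    have hne : x + ((n + 1 : ℕ) : ℝ) ≠ 0 := by push_cast; positivity
    have := sinc_pi_mul_add_nat_sq hne
    push_cast at this
    rw [this]
    field_simp
  have h2 : ∀ n : ℕ, Real.sinc (π * (-x + (n + 1))) ^ 2 =
      Real.sin (π * x) ^ 2 / π ^ 2 * (1 / (x - (n + 1)) ^ 2) := by
    intro n
    have hne : -x + ((n + 1 : ℕ) : ℝ) ≠ 0 := by
      push_cast
      intro h
      exact hxZ (n + 1) (by push_cast; linarith)
    have hne' : x - (n + 1) ≠ 0 := by
      intro h; apply hne; push_cast; linarith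
    have := sinc_pi_mul_neg_add_nat_sq hne
    push_cast at this
    rw [this]
    field_simp
  have h0 : Real.sinc (π * x) ^ 2 = Real.sin (π * x) ^ 2 / π ^ 2 * (1 / x ^ 2) := by
    rw [Real.sinc_of_ne_zero (mul_ne_zero Real.pi_ne_zero hx)]
    field_simp
  have hsum : ∑' n : ℕ, 1 / (x - (n + 1)) ^ 2 + ∑' n : ℕ, 1 / (x + (n + 1)) ^ 2 =
      π ^ 2 / Real.sin (π * x) ^ 2 - 1 / x ^ 2 :=
    (hs1.hasSum.add hs2.hasSum).unique hS
  have hreal : Real.sinc (π * x) ^ 2 + ∑' n : ℕ, Real.sinc (π * (x + (n + 1))) ^ 2 +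
      ∑' n : ℕ, Real.sinc (π * (-x + (n + 1))) ^ 2 = 1 := by
    simp_rw [h1, h2]
    rw [tsum_mul_left, tsum_mul_left, h0]
    set T₁ := ∑' n : ℕ, 1 / (x - (n + 1)) ^ 2 with hT₁
    set T₂ := ∑' n : ℕ, 1 / (x + (n + 1)) ^ 2 with hT₂
    calc Real.sin (π * x) ^ 2 / π ^ 2 * (1 / x ^ 2) + Real.sin (π * x) ^ 2 / π ^ 2 * T₂ +
          Real.sin (π * x) ^ 2 / π ^ 2 * T₁
        = Real.sin (π * x) ^ 2 / π ^ 2 * (1 / x ^ 2 + (T₁ + T₂)) := by ring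
      _ = Real.sin (π * x) ^ 2 / π ^ 2 * (1 / x ^ 2 + (π ^ 2 / Real.sin (π * x) ^ 2 - 1 / x ^ 2)) := by
          rw [hsum]
      _ = 1 := by field_simp; ring
  rw [hreal]
  simp

/-- **`Σ_{n∈ℤ} sincPi(z+n)² = 1` on all of `ℂ`** (identity theorem from the real interval
`(0,1)`). [cite: Vaaler1985, §1] -/
theorem sincSqPeriodisation_eq_one (z : ℂ) : sincSqPeriodisation z = 1 := by
  have hanal : AnalyticOnNhd ℂ sincSqPeriodisation univ :=
    differentiable_sincSqPeriodisation.differentiableOn.analyticOnNhd isOpen_univ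
  have hconst : AnalyticOnNhd ℂ (fun _ : ℂ ↦ (1 : ℂ)) univ := analyticOnNhd_const
  set u : ℕ → ℝ := fun k ↦ 1 / 2 + 1 / 4 * (1 / ((k : ℝ) + 1)) with hu
  have hu_mem : ∀ k, 0 < u k ∧ u k < 1 ∧ u k ≠ 1 / 2 := by
    intro k
    have hk : (0 : ℝ) < 1 / ((k : ℝ) + 1) := by positivity
    have hk1 : 1 / ((k : ℝ) + 1) ≤ 1 := by
      rw [div_le_one (by positivity)]; linarith [(Nat.cast_nonneg k : (0 : ℝ) ≤ k)]
    refine ⟨by simp only [hu]; positivity, by simp only [hu]; linarith, by simp only [hu]; linarith⟩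
  have ht : Tendsto (fun k : ℕ ↦ ((u k : ℝ) : ℂ)) atTop (𝓝[≠] (((1 / 2 : ℝ) : ℂ))) := by
    refine tendsto_nhdsWithin_iff.2 ⟨?_, Eventually.of_forall fun k ↦ ?_⟩
    · refine (Complex.continuous_ofReal.tendsto _).comp ?_
      have h0 : Tendsto (fun k : ℕ ↦ 1 / 2 + 1 / 4 * (1 / ((k : ℝ) + 1))) atTop
          (𝓝 (1 / 2 + 1 / 4 * 0)) :=
        tendsto_const_nhds.add (tendsto_const_nhds.mul tendsto_one_div_add_atTop_nhds_zero_nat)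
      simpa [hu] using h0
    · rw [mem_compl_singleton_iff, Ne, Complex.ofReal_inj]
      exact (hu_mem k).2.2
  have hfreq : ∃ᶠ w in 𝓝[≠] (((1 / 2 : ℝ) : ℂ)), sincSqPeriodisation w = (fun _ : ℂ ↦ (1 : ℂ)) w :=
    ht.frequently (Eventually.of_forall fun k ↦
      sincSqPeriodisation_eq_one_of_mem_Ioo (hu_mem k).1 (hu_mem k).2.1).frequently
  have := hanal.eqOn_of_preconnected_of_frequently_eq hconst isPreconnected_univ (mem_univ _) hfreq
  exact this (mem_univ z)

/-- **`B(z) + B(−z) = 2 sincPi(z)²`** on `ℂ`. [cite: Vaaler1985, Thm. 8 (proof)] -/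
theorem beurling_add_beurling_neg (z : ℂ) : beurling z + beurling (-z) = 2 * sincPi z ^ 2 := by
  have h := sincSqPeriodisation_eq_one z
  unfold sincSqPeriodisation at h
  unfold beurling
  rw [sincPi_neg]
  linear_combination (-2 : ℂ) * h

/-! ## Beurling's function on the real line -/

/-- Beurling's function at a real point, as a real number:
`B(x) = 1 + 2(x·sinc(πx)² − Σ_{n≥1} sinc(π(x+n))²)`. [cite: Vaaler1985, §1] -/
def beurlingReal (x : ℝ) : ℝ :=
  1 + 2 * (x * Real.sinc (π * x) ^ 2 - ∑' n : ℕ, Real.sinc (π * (x + (n + 1))) ^ 2)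

/-- `B(x)` is real for real `x`: `beurling x = beurlingReal x`. [folklore] -/
theorem beurling_ofReal (x : ℝ) : beurling x = (beurlingReal x : ℂ) := by
  unfold beurling beurlingReal
  simp_rw [sincPi_ofReal_add_sq]
  rw [← Complex.ofReal_tsum, sincPi_ofReal]
  push_cast; ring

/-- `B(0) = 1`. [cite: Vaaler1985, §1] -/
theorem beurlingReal_zero : beurlingReal 0 = 1 := by
  unfold beurlingReal
  have h : ∀ n : ℕ, Real.sinc (π * (0 + ((n : ℝ) + 1))) ^ 2 = 0 := by
    intro n
    have hne : π * (0 + ((n : ℝ) + 1)) ≠ 0 := by positivity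
    rw [Real.sinc_of_ne_zero hne]
    have : π * (0 + ((n : ℝ) + 1)) = ((n + 1 : ℕ) : ℝ) * π := by push_cast; ring
    rw [this, Real.sin_nat_mul_pi]; simp
  simp_rw [h]
  simp

/-- `B(x) + B(−x) = 2 sinc(πx)²` for real `x`. [cite: Vaaler1985, Thm. 8 (proof)] -/
theorem beurlingReal_add_beurlingReal_neg (x : ℝ) :
    beurlingReal x + beurlingReal (-x) = 2 * Real.sinc (π * x) ^ 2 := by
  have h := beurling_add_beurling_neg x
  rw [← Complex.ofReal_neg, beurling_ofReal, beurling_ofReal, sincPi_ofReal] at h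
  exact_mod_cast h

/-- The telescoping sum `Σ_{n≥0} (1/(x+n) − 1/(x+n+1)) = 1/x` for `x > 0`. [folklore] -/
lemma hasSum_inv_add_sub_inv_add_succ {x : ℝ} (hx : 0 < x) :
    HasSum (fun n : ℕ ↦ 1 / (x + n) - 1 / (x + n + 1)) (1 / x) := by
  have hterm : ∀ n : ℕ, 1 / (x + n) - 1 / (x + n + 1) = 1 / ((x + n) * (x + n + 1)) := by
    intro n
    have h1 : x + n ≠ 0 := by positivity
    have h2 : x + n + 1 ≠ 0 := by positivity
    field_simp; ring
  have hsum : Summable fun n : ℕ ↦ 1 / (x + n) - 1 / (x + n + 1) := by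
    simp_rw [hterm]
    refine Summable.of_nonneg_of_le (fun n ↦ by positivity) (fun n ↦ ?_)
      ((Real.summable_one_div_nat_add_rpow x 2).2 one_lt_two)
    rw [Real.rpow_two, abs_of_pos (by positivity : (0 : ℝ) < n + x)]
    apply one_div_le_one_div_of_le (by positivity)
    nlinarith [(Nat.cast_nonneg n : (0 : ℝ) ≤ n)]
  have h1 := hsum.hasSum.tendsto_sum_nat
  have h2 : Tendsto (fun N : ℕ ↦ ∑ i ∈ Finset.range N, (1 / (x + i) - 1 / (x + i + 1))) atTop
      (𝓝 (1 / x - 0)) := by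
    have heq : ∀ N : ℕ, ∑ i ∈ Finset.range N, (1 / (x + i) - 1 / (x + i + 1)) =
        1 / x - 1 / (x + N) := by
      intro N
      have := Finset.sum_range_sub' (fun i : ℕ ↦ 1 / (x + (i : ℝ))) N
      simp only [Nat.cast_zero, add_zero, Nat.cast_succ] at this
      rw [← this]
      refine Finset.sum_congr rfl fun i _ ↦ ?_
      ring
    simp_rw [heq]
    refine tendsto_const_nhds.sub ?_
    have : Tendsto (fun N : ℕ ↦ x + N) atTop atTop :=
      tendsto_atTop_add_const_left _ _ tendsto_natCast_atTop_atTop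
    have h3 := this.inv_tendsto_atTop
    simp only [one_div]
    exact h3
  have heq := tendsto_nhds_unique h1 h2
  rw [sub_zero] at heq
  exact heq ▸ hsum.hasSum

/-- For `x > 0`: `1/(x+1) ≤ Σ_{n≥0} 1/(x+n+1)² ≤ 1/x`. [folklore] -/
lemma tsum_inv_add_succ_sq_bounds {x : ℝ} (hx : 0 < x) :
    1 / (x + 1) ≤ ∑' n : ℕ, 1 / (x + (n + 1)) ^ 2 ∧ ∑' n : ℕ, 1 / (x + (n + 1)) ^ 2 ≤ 1 / x := by
  have hU := hasSum_inv_add_sub_inv_add_succ hx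
  have hL := hasSum_inv_add_sub_inv_add_succ (by linarith : (0 : ℝ) < x + 1)
  have hs : Summable fun n : ℕ ↦ 1 / (x + (n + 1)) ^ 2 := by
    refine Summable.of_nonneg_of_le (fun n ↦ by positivity) (fun n ↦ ?_) hU.summable
    have h1 : (0 : ℝ) < x + n := by positivity
    rw [div_sub_div _ _ h1.ne' (by positivity), div_le_div_iff₀ (by positivity) (by positivity)]
    nlinarith
  constructor
  · refine hasSum_le (fun n ↦ ?_) hL hs.hasSum
    have h1 : (0 : ℝ) < x + 1 + n := by positivity
    rw [div_sub_div _ _ h1.ne' (by positivity), div_le_div_iff₀ (by positivity) (by positivity)]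
    nlinarith
  · refine hasSum_le (fun n ↦ ?_) hs.hasSum hU
    have h1 : (0 : ℝ) < x + n := by positivity
    rw [div_sub_div _ _ h1.ne' (by positivity), div_le_div_iff₀ (by positivity) (by positivity)]
    nlinarith

/-- For `x > 0`: `B(x) − 1 = (2 sin²(πx)/π²)(1/x − Σ_{n≥0} 1/(x+n+1)²)`. [cite: Vaaler1985, §1] -/
theorem beurlingReal_sub_one_eq {x : ℝ} (hx : 0 < x) :
    beurlingReal x - 1 =
      2 * Real.sin (π * x) ^ 2 / π ^ 2 * (1 / x - ∑' n : ℕ, 1 / (x + (n + 1)) ^ 2) := by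
  unfold beurlingReal
  have h1 : ∀ n : ℕ, Real.sinc (π * (x + (n + 1))) ^ 2 =
      Real.sin (π * x) ^ 2 / π ^ 2 * (1 / (x + (n + 1)) ^ 2) := by
    intro n
    have hne : x + ((n + 1 : ℕ) : ℝ) ≠ 0 := by push_cast; positivity
    have := sinc_pi_mul_add_nat_sq hne
    push_cast at this
    rw [this]
    field_simp
  have h0 : x * Real.sinc (π * x) ^ 2 = Real.sin (π * x) ^ 2 / π ^ 2 * (1 / x) := by
    rw [Real.sinc_of_ne_zero (mul_ne_zero Real.pi_ne_zero hx.ne')]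
    field_simp
  simp_rw [h1]
  rw [tsum_mul_left, h0]
  ring

/-- **`1 ≤ B(x) ≤ 1 + 2sin²(πx)/(π²x(x+1))` for `x > 0`.** [cite: Vaaler1985, Thm. 8] -/
theorem beurlingReal_sub_one_bounds {x : ℝ} (hx : 0 < x) :
    0 ≤ beurlingReal x - 1 ∧
      beurlingReal x - 1 ≤ 2 * Real.sin (π * x) ^ 2 / (π ^ 2 * (x * (x + 1))) := by
  rw [beurlingReal_sub_one_eq hx]
  obtain ⟨hL, hU⟩ := tsum_inv_add_succ_sq_bounds hx
  have hs : 0 ≤ 2 * Real.sin (π * x) ^ 2 / π ^ 2 := by positivity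
  constructor
  · exact mul_nonneg hs (by linarith)
  · calc 2 * Real.sin (π * x) ^ 2 / π ^ 2 * (1 / x - ∑' n : ℕ, 1 / (x + (n + 1)) ^ 2)
        ≤ 2 * Real.sin (π * x) ^ 2 / π ^ 2 * (1 / x - 1 / (x + 1)) := by gcongr
      _ = 2 * Real.sin (π * x) ^ 2 / (π ^ 2 * (x * (x + 1))) := by
          field_simp
          ring

/-- **Beurling's inequality, right half-line**: `1 ≤ B(x)` for `x ≥ 0`. [cite: Vaaler1985, Thm. 8] -/
theorem one_le_beurlingReal {x : ℝ} (hx : 0 ≤ x) : 1 ≤ beurlingReal x := by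
  rcases hx.eq_or_lt with rfl | hx
  · rw [beurlingReal_zero]
  · linarith [(beurlingReal_sub_one_bounds hx).1]

/-- **`0 ≤ B(−x) + 1 ≤ 2 sinc(πx)²` for `x > 0`.** [cite: Vaaler1985, Thm. 8] -/
theorem beurlingReal_neg_add_one_bounds {x : ℝ} (hx : 0 < x) :
    0 ≤ beurlingReal (-x) + 1 ∧ beurlingReal (-x) + 1 ≤ 2 * Real.sinc (π * x) ^ 2 := by
  have hadd := beurlingReal_add_beurlingReal_neg x
  obtain ⟨h0, h1⟩ := beurlingReal_sub_one_bounds hx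
  have hsinc : Real.sinc (π * x) ^ 2 = Real.sin (π * x) ^ 2 / (π ^ 2 * x ^ 2) := by
    rw [Real.sinc_of_ne_zero (mul_ne_zero Real.pi_ne_zero hx.ne')]
    field_simp
  constructor
  · -- `B(−x) + 1 = 2 sinc² − (B(x) − 1) ≥ 2sin²/(π²x²) − 2sin²/(π²x(x+1)) ≥ 0`
    have hcmp : 2 * Real.sin (π * x) ^ 2 / (π ^ 2 * (x * (x + 1))) ≤
        2 * (Real.sin (π * x) ^ 2 / (π ^ 2 * x ^ 2)) := by
      rw [← mul_div_assoc, div_le_div_iff₀ (by positivity) (by positivity)]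
      have : 0 ≤ 2 * Real.sin (π * x) ^ 2 * π ^ 2 * x := by positivity
      nlinarith
    rw [← hsinc] at hcmp
    linarith
  · linarith

/-- **Beurling's inequality, left half-line**: `−1 ≤ B(x)` for all real `x`. [cite: Vaaler1985, Thm. 8] -/
theorem neg_one_le_beurlingReal (x : ℝ) : -1 ≤ beurlingReal x := by
  rcases lt_or_ge x 0 with hx | hx
  · have := (beurlingReal_neg_add_one_bounds (by linarith : 0 < -x)).1
    rw [neg_neg] at this
    linarith
  · linarith [one_le_beurlingReal hx]

/-- **Beurling's inequality `sgn x ≤ B(x)`.** [cite: Vaaler1985, Thm. 8] -/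
theorem sign_le_beurlingReal (x : ℝ) : Real.sign x ≤ beurlingReal x := by
  rcases lt_trichotomy x 0 with hx | rfl | hx
  · rw [Real.sign_of_neg hx]; exact neg_one_le_beurlingReal x
  · rw [Real.sign_zero, beurlingReal_zero]; norm_num
  · rw [Real.sign_of_pos hx]; exact one_le_beurlingReal hx.le

/-- `0 ≤ B(x) − sgn x ≤ 2` for all real `x`. [cite: Vaaler1985, Thm. 8] -/
theorem beurlingReal_sub_sign_le_two (x : ℝ) : beurlingReal x - Real.sign x ≤ 2 := by
  rcases lt_trichotomy x 0 with hx | rfl | hx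
  · rw [Real.sign_of_neg hx]
    have h := (beurlingReal_neg_add_one_bounds (by linarith : 0 < -x)).2
    rw [neg_neg] at h
    linarith [sinc_sq_le_one (π * -x)]
  · rw [Real.sign_zero, beurlingReal_zero]; norm_num
  · rw [Real.sign_of_pos hx]
    have h := (beurlingReal_sub_one_bounds hx).2
    have h2 : 2 * Real.sin (π * x) ^ 2 / (π ^ 2 * (x * (x + 1))) ≤ 2 := by
      rw [div_le_iff₀ (by positivity)]
      have hs : Real.sin (π * x) ^ 2 ≤ (π * x) ^ 2 := Real.sin_sq_le_sq
      nlinarith [Real.pi_pos, sq_nonneg (π * x)]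
    linarith

/-- **Decay**: `B(x) − sgn x ≤ 2/(π²x²)` for `x ≠ 0`. [cite: Vaaler1985, Thm. 8] -/
theorem beurlingReal_sub_sign_le_div {x : ℝ} (hx : x ≠ 0) :
    beurlingReal x - Real.sign x ≤ 2 / (π ^ 2 * x ^ 2) := by
  rcases lt_or_gt_of_ne hx with hx | hx
  · rw [Real.sign_of_neg hx]
    have h := (beurlingReal_neg_add_one_bounds (by linarith : 0 < -x)).2
    rw [neg_neg] at h
    have h2 : Real.sinc (π * -x) ^ 2 ≤ 1 / (π * -x) ^ 2 :=
      sinc_sq_le_inv_sq (mul_ne_zero Real.pi_ne_zero (by linarith))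
    calc beurlingReal x - -1 = beurlingReal x + 1 := by ring
      _ ≤ 2 * Real.sinc (π * -x) ^ 2 := h
      _ ≤ 2 * (1 / (π * -x) ^ 2) := by gcongr
      _ = 2 / (π ^ 2 * x ^ 2) := by field_simp
  · rw [Real.sign_of_pos hx]
    have h := (beurlingReal_sub_one_bounds hx).2
    calc beurlingReal x - 1 ≤ 2 * Real.sin (π * x) ^ 2 / (π ^ 2 * (x * (x + 1))) := h
      _ ≤ 2 * 1 / (π ^ 2 * (x * x)) := by
          gcongr
          · rw [sq_le_one_iff_abs_le_one]; exact Real.abs_sin_le_one _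
          · linarith
      _ = 2 / (π ^ 2 * x ^ 2) := by ring

/-- `0 ≤ B(x) − sgn x`. [cite: Vaaler1985, Thm. 8] -/
theorem beurlingReal_sub_sign_nonneg (x : ℝ) : 0 ≤ beurlingReal x - Real.sign x := by
  linarith [sign_le_beurlingReal x]

/-! ## `∫ sinc(πx)² dx = 1` by periodisation, and `∫ (B − sgn) = 1` -/

/-- The periodisation at a real point, in real terms. [folklore] -/
theorem sincSqPeriodisation_ofReal (x : ℝ) :
    sincSqPeriodisation x = ((Real.sinc (π * x) ^ 2 + ∑' n : ℕ, Real.sinc (π * (x + (n + 1))) ^ 2 +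
      ∑' n : ℕ, Real.sinc (π * (-x + (n + 1))) ^ 2 : ℝ) : ℂ) := by
  unfold sincSqPeriodisation
  simp_rw [sincPi_ofReal_add_sq, sincPi_neg_ofReal_add_sq]
  rw [← Complex.ofReal_tsum, ← Complex.ofReal_tsum, sincPi_ofReal]
  push_cast; ring

/-- **`Σ_{n∈ℤ} sinc(π(x+n))² = 1`** for every real `x`. [cite: Vaaler1985, §1] -/
theorem hasSum_int_sinc_sq (x : ℝ) : HasSum (fun n : ℤ ↦ Real.sinc (π * (x + n)) ^ 2) 1 := by
  have hreal : Real.sinc (π * x) ^ 2 + ∑' n : ℕ, Real.sinc (π * (x + (n + 1))) ^ 2 +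
      ∑' n : ℕ, Real.sinc (π * (-x + (n + 1))) ^ 2 = 1 := by
    have h := sincSqPeriodisation_eq_one x
    rw [sincSqPeriodisation_ofReal] at h
    exact_mod_cast h
  have h1 : HasSum (fun n : ℕ ↦ Real.sinc (π * (x + ((n : ℤ) : ℝ))) ^ 2)
      (∑' n : ℕ, Real.sinc (π * (x + (n + 1))) ^ 2 + Real.sinc (π * x) ^ 2) := by
    have h := (summable_sinc_sq_add x).hasSum
    have h' : HasSum (fun n : ℕ ↦ Real.sinc (π * (x + (((n + 1 : ℕ) : ℤ) : ℝ))) ^ 2)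
        (∑' n : ℕ, Real.sinc (π * (x + (n + 1))) ^ 2) := by
      convert h using 2 with n
      push_cast; ring
    rw [hasSum_nat_add_iff (f := fun n : ℕ ↦ Real.sinc (π * (x + ((n : ℤ) : ℝ))) ^ 2) 1] at h'
    simpa using h'
  have h2 : HasSum (fun n : ℕ ↦ Real.sinc (π * (x + ((-((n : ℤ) + 1) : ℤ) : ℝ))) ^ 2)
      (∑' n : ℕ, Real.sinc (π * (-x + (n + 1))) ^ 2) := by
    convert (summable_sinc_sq_neg_add x).hasSum using 2 with n
    rw [← Real.sinc_neg]
    congr 1; push_cast; ring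
  have h3 := HasSum.of_nat_of_neg_add_one (f := fun n : ℤ ↦ Real.sinc (π * (x + n)) ^ 2) h1 h2
  convert h3 using 1
  linarith

/-- Measurability of `x ↦ sinc(πx)²`. [folklore] -/
lemma measurable_sinc_sq : Measurable fun x : ℝ ↦ Real.sinc (π * x) ^ 2 :=
  ((Real.continuous_sinc.comp (continuous_const.mul continuous_id)).pow 2).measurable

/-- **`∫ sinc(πx)² dx = 1`** (as a lower integral), by periodisation over `ℤ + (0,1]`.
[cite: Vaaler1985, §1] -/
theorem lintegral_sinc_sq : ∫⁻ x : ℝ, ENNReal.ofReal (Real.sinc (π * x) ^ 2) = 1 := by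
  set G : ℝ → ENNReal := fun u ↦ ENNReal.ofReal (Real.sinc (π * u) ^ 2) with hG
  have hGm : Measurable G := ENNReal.measurable_ofReal.comp measurable_sinc_sq
  have h1 : ∀ x : ℝ, ∑' n : ℤ, G (x + n) = 1 := by
    intro x
    have h := hasSum_int_sinc_sq x
    simp only [hG]
    rw [← ENNReal.ofReal_tsum_of_nonneg (fun n ↦ sq_nonneg _) h.summable, h.tsum_eq,
      ENNReal.ofReal_one]
  have h2 : ∫⁻ x in Ioc (0 : ℝ) 1, ∑' n : ℤ, G (x + n) = 1 := by
    simp_rw [h1]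
    simp
  have h3 : ∫⁻ x in Ioc (0 : ℝ) 1, ∑' n : ℤ, G (x + n) = ∑' n : ℤ, ∫⁻ x in Ioc (0 : ℝ) 1, G (x + n) :=
    lintegral_tsum fun n ↦ (hGm.comp (measurable_id.add_const _)).aemeasurable
  have h4 : ∀ n : ℤ, ∫⁻ x in Ioc (0 : ℝ) 1, G (x + n) = ∫⁻ u in Ioc (n : ℝ) (n + 1), G u := by
    intro n
    rw [← lintegral_indicator measurableSet_Ioc, ← lintegral_indicator measurableSet_Ioc]
    have heq : (fun x : ℝ ↦ (Ioc (0 : ℝ) 1).indicator (fun x ↦ G (x + n)) x) =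
        fun x : ℝ ↦ (Ioc (n : ℝ) (n + 1)).indicator G (x + n) := by
      funext x
      have hiff : x + n ∈ Ioc (n : ℝ) (n + 1) ↔ x ∈ Ioc (0 : ℝ) 1 := by
        simp only [mem_Ioc]
        constructor <;> rintro ⟨ha, hb⟩ <;> constructor <;> linarith
      by_cases hx : x ∈ Ioc (0 : ℝ) 1
      · rw [indicator_of_mem hx, indicator_of_mem (hiff.2 hx)]
      · rw [indicator_of_notMem hx, indicator_of_notMem (mt hiff.1 hx)]
    rw [heq, lintegral_add_right_eq_self]
  have h5 : ∑' n : ℤ, ∫⁻ u in Ioc (n : ℝ) (n + 1), G u = ∫⁻ u, G u := by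
    rw [← lintegral_iUnion (fun n ↦ measurableSet_Ioc) (pairwise_disjoint_Ioc_intCast ℝ),
      iUnion_Ioc_intCast, Measure.restrict_univ]
  simp_rw [h4] at h3
  rw [← h5, ← h3, h2]

/-- **`∫ sinc(πx)² dx = 1`.** [cite: Vaaler1985, §1] -/
theorem integral_sinc_sq : ∫ x : ℝ, Real.sinc (π * x) ^ 2 = 1 := by
  rw [integral_eq_lintegral_of_nonneg_ae (Eventually.of_forall fun x ↦ sq_nonneg _)
    measurable_sinc_sq.aestronglyMeasurable, lintegral_sinc_sq]
  simp

/-- `x ↦ sinc(πx)²` is integrable. [folklore] -/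
theorem integrable_sinc_sq : Integrable fun x : ℝ ↦ Real.sinc (π * x) ^ 2 := by
  refine ⟨measurable_sinc_sq.aestronglyMeasurable, ?_⟩
  rw [hasFiniteIntegral_iff_ofReal (Eventually.of_forall fun x ↦ sq_nonneg _), lintegral_sinc_sq]
  exact ENNReal.one_lt_top

/-- Splitting an integral over `ℝ` at the origin: `∫ φ = ∫_{(0,∞)} (φ(x) + φ(−x)) dx`. [folklore] -/
lemma integral_eq_integral_Ioi_add_neg {φ : ℝ → ℝ} (hφ : Integrable φ) :
    ∫ x, φ x = ∫ x in Ioi (0 : ℝ), (φ x + φ (-x)) := by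
  rw [← integral_add_compl (measurableSet_Ioi (a := (0 : ℝ))) hφ, compl_Ioi,
    integral_add hφ.integrableOn hφ.comp_neg.integrableOn, integral_comp_neg_Ioi, neg_zero]

/-- `B` restricted to `ℝ` is continuous. [folklore] -/
theorem continuous_beurlingReal : Continuous beurlingReal := by
  have h : beurlingReal = fun x : ℝ ↦ (beurling x).re := by
    funext x; rw [beurling_ofReal, Complex.ofReal_re]
  rw [h]
  exact Complex.continuous_re.comp (continuous_beurling.comp Complex.continuous_ofReal)

/-- `|B(x) − sgn x| ≤ 4/(1+x²)`. [cite: Vaaler1985, Thm. 8] -/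
theorem abs_beurlingReal_sub_sign_le (x : ℝ) :
    |beurlingReal x - Real.sign x| ≤ 4 * (1 + x ^ 2)⁻¹ := by
  rw [abs_of_nonneg (beurlingReal_sub_sign_nonneg x)]
  have hpos : 0 < 1 + x ^ 2 := by positivity
  rcases le_or_gt (x ^ 2) 1 with hx | hx
  · calc beurlingReal x - Real.sign x ≤ 2 := beurlingReal_sub_sign_le_two x
      _ ≤ 4 * (1 + x ^ 2)⁻¹ := by
          rw [← div_eq_mul_inv, le_div_iff₀ hpos]; nlinarith
  · have hx0 : x ≠ 0 := by rintro rfl; norm_num at hx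
    calc beurlingReal x - Real.sign x ≤ 2 / (π ^ 2 * x ^ 2) := beurlingReal_sub_sign_le_div hx0
      _ ≤ 2 / (1 * x ^ 2) := by
          gcongr; nlinarith [Real.pi_gt_three]
      _ ≤ 4 * (1 + x ^ 2)⁻¹ := by
          rw [one_mul, ← div_eq_mul_inv, div_le_div_iff₀ (by positivity) hpos]; nlinarith

/-- `B − sgn` is integrable on `ℝ`. [cite: Vaaler1985, Thm. 8] -/
theorem integrable_beurlingReal_sub_sign : Integrable fun x ↦ beurlingReal x - Real.sign x := by
  have hsign : Measurable Real.sign := by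
    have h : Real.sign = fun r : ℝ ↦ if r < 0 then (-1 : ℝ) else if 0 < r then 1 else 0 := by
      funext r; rfl
    rw [h]
    exact Measurable.ite measurableSet_Iio measurable_const
      (Measurable.ite measurableSet_Ioi measurable_const measurable_const)
  refine Integrable.mono' (integrable_inv_one_add_sq.const_mul 4)
    (continuous_beurlingReal.measurable.sub hsign).aestronglyMeasurable
    (Eventually.of_forall fun x ↦ ?_)
  rw [Real.norm_eq_abs]
  exact abs_beurlingReal_sub_sign_le x

/-- **`∫ (B(x) − sgn x) dx = 1`** (Beurling; Vaaler 1985, Thm. 8 with `∫(B − sgn) = 1`).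
[cite: Vaaler1985, Thm. 8] -/
theorem integral_beurlingReal_sub_sign : ∫ x, (beurlingReal x - Real.sign x) = 1 := by
  rw [integral_eq_integral_Ioi_add_neg integrable_beurlingReal_sub_sign]
  have h1 : ∫ x in Ioi (0 : ℝ), (beurlingReal x - Real.sign x + (beurlingReal (-x) - Real.sign (-x))) =
      ∫ x in Ioi (0 : ℝ), (Real.sinc (π * x) ^ 2 + Real.sinc (π * -x) ^ 2) := by
    refine setIntegral_congr_fun measurableSet_Ioi fun x hx ↦ ?_
    have hx : 0 < x := hx
    rw [Real.sign_of_pos hx, Real.sign_of_neg (by linarith : -x < 0), mul_neg, Real.sinc_neg]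
    linarith [beurlingReal_add_beurlingReal_neg x]
  rw [h1, ← integral_eq_integral_Ioi_add_neg (φ := fun x ↦ Real.sinc (π * x) ^ 2) integrable_sinc_sq,
    integral_sinc_sq]

/-! ## Growth of `B` in the complex plane -/

/-- For `Re z ≥ 0` and `n ≥ 0`: `|z + n|² ≥ |z|² + n²`. [folklore] -/
lemma norm_sq_add_nat_ge {z : ℂ} (hz : 0 ≤ z.re) (n : ℕ) :
    ‖z‖ ^ 2 + (n : ℝ) ^ 2 ≤ ‖z + n‖ ^ 2 := by
  rw [Complex.sq_norm, Complex.sq_norm, Complex.normSq_apply, Complex.normSq_apply]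
  simp only [Complex.add_re, Complex.natCast_re, Complex.add_im, Complex.natCast_im, add_zero]
  nlinarith [(Nat.cast_nonneg n : (0 : ℝ) ≤ n)]

/-- For `Re z ≥ 0` and `n ≥ 0`: `|z + n| ≥ |z|`. [folklore] -/
private lemma norm_le_norm_add_nat {z : ℂ} (hz : 0 ≤ z.re) (n : ℕ) : ‖z‖ ≤ ‖z + n‖ := by
  have h := norm_sq_add_nat_ge hz n
  have h2 : ‖z‖ ^ 2 ≤ ‖z + n‖ ^ 2 := by nlinarith [sq_nonneg (n : ℝ)]
  exact (pow_le_pow_iff_left₀ (norm_nonneg _) (norm_nonneg _) two_ne_zero).1 h2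

/-- For `Re z ≥ 0`, `|z| ≥ 1`, `n ≥ 0`: `z + n ≠ 0`. [folklore] -/
lemma add_nat_ne_zero {z : ℂ} (hz : 0 ≤ z.re) (hz1 : 1 ≤ ‖z‖) (n : ℕ) : z + n ≠ 0 := by
  intro h
  have := norm_le_norm_add_nat hz n
  rw [h, norm_zero] at this
  linarith

/-- The telescoping sum `Σ_{n≥0} (1/(z+n) − 1/(z+n+1)) = 1/z` (`Re z ≥ 0`, `|z| ≥ 1`). [folklore] -/
lemma hasSum_inv_add_sub_inv_add_succ_complex {z : ℂ} (hz : 0 ≤ z.re) (hz1 : 1 ≤ ‖z‖) :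
    HasSum (fun n : ℕ ↦ 1 / (z + n) - 1 / (z + n + 1)) (1 / z) := by
  have hne : ∀ n : ℕ, z + n ≠ 0 := add_nat_ne_zero hz hz1
  have hne' : ∀ n : ℕ, z + n + 1 ≠ 0 := fun n ↦ by
    have := hne (n + 1); push_cast at this; rwa [← add_assoc] at this
  have hterm : ∀ n : ℕ, 1 / (z + n) - 1 / (z + n + 1) = 1 / ((z + n) * (z + n + 1)) := by
    intro n; field_simp [hne n, hne' n]; ring
  -- norms: `|z+n| |z+n+1| ≥ (n+1)²/2`
  have hlow : ∀ n : ℕ, ((n : ℝ) + 1) ^ 2 / 2 ≤ ‖(z + n) * (z + n + 1)‖ := by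
    intro n
    rw [norm_mul]
    have h1 : Real.sqrt (1 + (n : ℝ) ^ 2) ≤ ‖z + n‖ := by
      refine Real.sqrt_le_iff.2 ⟨norm_nonneg _, ?_⟩
      nlinarith [norm_sq_add_nat_ge hz n]
    have h2 : Real.sqrt (1 + ((n : ℝ) + 1) ^ 2) ≤ ‖z + n + 1‖ := by
      refine Real.sqrt_le_iff.2 ⟨norm_nonneg _, ?_⟩
      have := norm_sq_add_nat_ge hz (n + 1)
      push_cast at this
      rw [← add_assoc] at this
      nlinarith
    have h3 : ((n : ℝ) + 1) / Real.sqrt 2 ≤ Real.sqrt (1 + (n : ℝ) ^ 2) := by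
      rw [div_le_iff₀ (by positivity), ← Real.sqrt_mul (by positivity),
        Real.le_sqrt (by positivity) (by positivity)]
      nlinarith [sq_nonneg ((n : ℝ) - 1)]
    have h4 : ((n : ℝ) + 1) / Real.sqrt 2 ≤ Real.sqrt (1 + ((n : ℝ) + 1) ^ 2) := by
      rw [div_le_iff₀ (by positivity), ← Real.sqrt_mul (by positivity),
        Real.le_sqrt (by positivity) (by positivity)]
      nlinarith [sq_nonneg ((n : ℝ) + 1)]
    have hs2 : Real.sqrt 2 ^ 2 = 2 := Real.sq_sqrt (by norm_num)
    calc ((n : ℝ) + 1) ^ 2 / 2 = (((n : ℝ) + 1) / Real.sqrt 2) * (((n : ℝ) + 1) / Real.sqrt 2) := by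
          rw [div_mul_div_comm, ← sq, ← sq, hs2]
      _ ≤ ‖z + n‖ * ‖z + n + 1‖ :=
          mul_le_mul (h3.trans h1) (h4.trans h2) (by positivity) (norm_nonneg _)
  have hsum : Summable fun n : ℕ ↦ 1 / (z + n) - 1 / (z + n + 1) := by
    simp_rw [hterm]
    refine Summable.of_norm_bounded (g := fun n : ℕ ↦ 2 / ((n : ℝ) + 1) ^ 2) ?_ (fun n ↦ ?_)
    · simp_rw [div_eq_mul_inv]
      refine Summable.mul_left _ ?_
      have := (summable_nat_add_iff 1).2 (Real.summable_nat_pow_inv.2 one_lt_two)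
      simpa [Nat.cast_add, Nat.cast_one] using this
    · rw [norm_div, norm_one, div_le_div_iff₀ (norm_pos_iff.2 (mul_ne_zero (hne n) (hne' n)))
        (by positivity)]
      nlinarith [hlow n]
  have h1 := hsum.hasSum.tendsto_sum_nat
  have h2 : Tendsto (fun N : ℕ ↦ ∑ i ∈ Finset.range N, (1 / (z + i) - 1 / (z + i + 1))) atTop
      (𝓝 (1 / z - 0)) := by
    have heq : ∀ N : ℕ, ∑ i ∈ Finset.range N, (1 / (z + i) - 1 / (z + i + 1)) =
        1 / z - 1 / (z + N) := by
      intro N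
      have := Finset.sum_range_sub' (fun i : ℕ ↦ 1 / (z + (i : ℂ))) N
      simp only [Nat.cast_zero, add_zero, Nat.cast_succ] at this
      rw [← this]
      refine Finset.sum_congr rfl fun i _ ↦ ?_
      ring
    simp_rw [heq]
    refine tendsto_const_nhds.sub ?_
    rw [tendsto_zero_iff_norm_tendsto_zero]
    have hb : ∀ N : ℕ, ‖1 / (z + N)‖ ≤ 1 / Real.sqrt (1 + (N : ℝ) ^ 2) := by
      intro N
      rw [norm_div, norm_one]
      apply one_div_le_one_div_of_le (by positivity)
      refine Real.sqrt_le_iff.2 ⟨norm_nonneg _, ?_⟩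
      nlinarith [norm_sq_add_nat_ge hz N]
    refine squeeze_zero (fun N ↦ norm_nonneg _) hb ?_
    have ht : Tendsto (fun N : ℕ ↦ Real.sqrt (1 + (N : ℝ) ^ 2)) atTop atTop := by
      refine Real.tendsto_sqrt_atTop.comp ?_
      refine tendsto_atTop_add_const_left _ _ ?_
      exact (tendsto_pow_atTop two_ne_zero).comp tendsto_natCast_atTop_atTop
    have ht' := ht.inv_tendsto_atTop
    simp only [one_div]
    exact ht'
  have heq := tendsto_nhds_unique h1 h2
  rw [sub_zero] at heq
  exact heq ▸ hsum.hasSum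

/-- Summability of `Σ 1/(z+n+1)²` (`Re z ≥ 0`). [folklore] -/
lemma summable_inv_add_succ_sq_complex {z : ℂ} (hz : 0 ≤ z.re) :
    Summable fun n : ℕ ↦ 1 / (z + (n + 1)) ^ 2 := by
  refine Summable.of_norm_bounded (g := fun n : ℕ ↦ 1 / ((n : ℝ) + 1) ^ 2) ?_ (fun n ↦ ?_)
  · have := (summable_nat_add_iff 1).2 (Real.summable_nat_pow_inv.2 one_lt_two)
    simpa [Nat.cast_add, Nat.cast_one] using this
  · rw [norm_div, norm_one, norm_pow]
    apply one_div_le_one_div_of_le (by positivity)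
    have h := norm_sq_add_nat_ge hz (n + 1)
    push_cast at h
    nlinarith [norm_nonneg z]

/-- **The key estimate** `|1/z − Σ_{n≥0} 1/(z+n+1)²| ≤ 2/|z|²` for `Re z ≥ 0`, `|z| ≥ 1`
(exact telescoping `1/z − Σ(z+n+1)⁻² = Σ 1/((z+n)(z+n+1)²)`). [folklore] -/
theorem norm_inv_sub_tsum_inv_add_succ_sq_le {z : ℂ} (hz : 0 ≤ z.re) (hz1 : 1 ≤ ‖z‖) :
    ‖1 / z - ∑' n : ℕ, 1 / (z + (n + 1)) ^ 2‖ ≤ 2 / ‖z‖ ^ 2 := by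
  have hne : ∀ n : ℕ, z + n ≠ 0 := add_nat_ne_zero hz hz1
  have hne' : ∀ n : ℕ, z + (n + 1) ≠ 0 := fun n ↦ by
    have := hne (n + 1); push_cast at this; exact this
  have hA := hasSum_inv_add_sub_inv_add_succ_complex hz hz1
  have hB := (summable_inv_add_succ_sq_complex hz).hasSum
  have hdiff := hA.sub hB
  have hterm : ∀ n : ℕ, 1 / (z + n) - 1 / (z + n + 1) - 1 / (z + (n + 1)) ^ 2 =
      1 / ((z + n) * (z + (n + 1)) ^ 2) := by
    intro n
    have h3 : z + n + 1 ≠ 0 := by rw [add_assoc]; exact hne' n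
    field_simp [hne n, hne' n, h3]
    ring
  simp_rw [hterm] at hdiff
  rw [← hdiff.tsum_eq]
  set r : ℝ := ‖z‖ with hr
  have hr1 : 1 ≤ r := hz1
  have hr0 : 0 < r := by linarith
  have hR := hasSum_inv_add_sub_inv_add_succ hr0
  -- majorant `g n = (1/r) · 2 (1/(r+n) − 1/(r+n+1))`, sum `(1/r)(2/r)`
  have hg : HasSum (fun n : ℕ ↦ 1 / r * (2 * (1 / (r + n) - 1 / (r + n + 1)))) (1 / r * (2 * (1 / r))) :=
    (hR.mul_left 2).mul_left (1 / r)
  have hval : 1 / r * (2 * (1 / r)) = 2 / r ^ 2 := by field_simp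
  rw [← hval]
  refine tsum_of_norm_bounded hg fun n ↦ ?_
  have hzn : r ≤ ‖z + n‖ := norm_le_norm_add_nat hz n
  have hzn1 : r ^ 2 + ((n : ℝ) + 1) ^ 2 ≤ ‖z + (n + 1)‖ ^ 2 := by
    have := norm_sq_add_nat_ge hz (n + 1); push_cast at this; exact this
  have hpos1 : 0 < ‖z + n‖ := lt_of_lt_of_le hr0 hzn
  have hpos2 : 0 < ‖z + (n + 1)‖ ^ 2 := by nlinarith
  rw [norm_div, norm_one, norm_mul, norm_pow]
  have htel : 1 / (r + n) - 1 / (r + n + 1) = 1 / ((r + n) * (r + n + 1)) := by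
    have h1 : r + n ≠ 0 := by positivity
    have h2 : r + n + 1 ≠ 0 := by positivity
    field_simp; ring
  rw [htel]
  -- `1/(|z+n| |z+n+1|²) ≤ (1/r) · 2/((r+n)(r+n+1))`
  have hkey : (r + n) * (r + n + 1) ≤ 2 * (r ^ 2 + ((n : ℝ) + 1) ^ 2) := by
    nlinarith [sq_nonneg (r - ((n : ℝ) + 1)), (Nat.cast_nonneg n : (0 : ℝ) ≤ n)]
  rw [div_le_iff₀ (mul_pos hpos1 hpos2)]
  calc (1 : ℝ) = 1 / r * (2 * (1 / ((r + n) * (r + n + 1)))) * (r * ((r + n) * (r + n + 1) / 2)) := by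
        field_simp
    _ ≤ 1 / r * (2 * (1 / ((r + n) * (r + n + 1)))) * (‖z + n‖ * ‖z + (n + 1)‖ ^ 2) := by
        apply mul_le_mul_of_nonneg_left _ (by positivity)
        exact mul_le_mul hzn (by linarith [hkey, hzn1]) (by positivity) (norm_nonneg _)

/-- `sincPi(z + n + 1)² = sin²(πz)/(π²(z+n+1)²)` (natural shift). [folklore] -/
lemma sincPi_add_nat_succ_sq {z : ℂ} {n : ℕ} (h : z + (n + 1) ≠ 0) :
    sincPi (z + (n + 1)) ^ 2 = Complex.sin (π * z) ^ 2 / (π ^ 2 * (z + (n + 1)) ^ 2) := by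
  have h' : z + ((n + 1 : ℕ) : ℤ) ≠ 0 := by push_cast; exact h
  have := sincPi_add_intCast_sq h'
  push_cast at this
  exact this

/-- For `Re z ≥ 0`, `|z| ≥ 1`: `B(z) − 1 = (2 sin²(πz)/π²)(1/z − Σ_{n≥0} 1/(z+n+1)²)`.
[cite: Vaaler1985, §1] -/
theorem beurling_sub_one_eq {z : ℂ} (hz : 0 ≤ z.re) (hz1 : 1 ≤ ‖z‖) :
    beurling z - 1 =
      2 * Complex.sin (π * z) ^ 2 / π ^ 2 * (1 / z - ∑' n : ℕ, 1 / (z + (n + 1)) ^ 2) := by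
  have hne : ∀ n : ℕ, z + n ≠ 0 := add_nat_ne_zero hz hz1
  have hz0 : z ≠ 0 := by have := hne 0; simpa using this
  have hne' : ∀ n : ℕ, z + (n + 1) ≠ 0 := fun n ↦ by
    have := hne (n + 1); push_cast at this; exact this
  have hπ : (π : ℂ) ≠ 0 := ofReal_ne_zero.2 Real.pi_ne_zero
  unfold beurling
  have h1 : ∀ n : ℕ, sincPi (z + (n + 1)) ^ 2 =
      Complex.sin (π * z) ^ 2 / π ^ 2 * (1 / (z + (n + 1)) ^ 2) := by
    intro n
    rw [sincPi_add_nat_succ_sq (hne' n)]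
    field_simp
  have h0 : z * sincPi z ^ 2 = Complex.sin (π * z) ^ 2 / π ^ 2 * (1 / z) := by
    rw [sincPi_of_ne_zero hz0]
    field_simp
  simp_rw [h1]
  rw [tsum_mul_left, h0]
  ring

/-- **`|B(z) − 1| ≤ e^{2π|Im z|}/|z|²` for `Re z ≥ 0`, `|z| ≥ 1`.** [cite: Vaaler1985, §1] -/
theorem norm_beurling_sub_one_le {z : ℂ} (hz : 0 ≤ z.re) (hz1 : 1 ≤ ‖z‖) :
    ‖beurling z - 1‖ ≤ Real.exp (2 * π * |z.im|) / ‖z‖ ^ 2 := by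
  rw [beurling_sub_one_eq hz hz1, norm_mul]
  have h1 : ‖2 * Complex.sin (π * z) ^ 2 / (π : ℂ) ^ 2‖ = 2 * ‖Complex.sin (π * z)‖ ^ 2 / π ^ 2 := by
    rw [norm_div, norm_mul, norm_pow, norm_pow]
    simp [abs_of_pos Real.pi_pos]
  rw [h1]
  have h2 := norm_inv_sub_tsum_inv_add_succ_sq_le hz hz1
  have h3 := norm_sin_pi_mul_sq_le z
  have hz0 : 0 < ‖z‖ := by linarith
  calc 2 * ‖Complex.sin (π * z)‖ ^ 2 / π ^ 2 * ‖1 / z - ∑' n : ℕ, 1 / (z + (n + 1)) ^ 2‖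
      ≤ 2 * Real.exp (2 * π * |z.im|) / π ^ 2 * (2 / ‖z‖ ^ 2) := by gcongr
    _ = (4 / π ^ 2) * (Real.exp (2 * π * |z.im|) / ‖z‖ ^ 2) := by ring
    _ ≤ 1 * (Real.exp (2 * π * |z.im|) / ‖z‖ ^ 2) := by
        gcongr
        rw [div_le_one (by positivity)]
        nlinarith [Real.pi_gt_three]
    _ = Real.exp (2 * π * |z.im|) / ‖z‖ ^ 2 := one_mul _

/-- **`|B(z) + 1| ≤ 2e^{2π|Im z|}/|z|²` for `Re z ≤ 0`, `|z| ≥ 1`** (from `B(z) + B(−z) = 2sincPi²`).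
[cite: Vaaler1985, §1] -/
theorem norm_beurling_add_one_le {z : ℂ} (hz : z.re ≤ 0) (hz1 : 1 ≤ ‖z‖) :
    ‖beurling z + 1‖ ≤ 2 * Real.exp (2 * π * |z.im|) / ‖z‖ ^ 2 := by
  have hneg : 0 ≤ (-z).re := by simp; linarith
  have hneg1 : 1 ≤ ‖-z‖ := by rwa [norm_neg]
  have h1 := norm_beurling_sub_one_le hneg hneg1
  rw [norm_neg, Complex.neg_im, abs_neg] at h1
  have hid : beurling z + 1 = 2 * sincPi z ^ 2 - (beurling (-z) - 1) := by
    linear_combination beurling_add_beurling_neg z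
  rw [hid]
  have hz0 : z ≠ 0 := by rintro rfl; norm_num at hz1
  have hzpos : 0 < ‖z‖ := by linarith
  have h2 : ‖2 * sincPi z ^ 2‖ ≤ Real.exp (2 * π * |z.im|) / ‖z‖ ^ 2 := by
    rw [norm_mul, norm_pow, Complex.norm_two]
    have hs := norm_sincPi_le_div hz0
    have hs0 : 0 ≤ ‖sincPi z‖ := norm_nonneg _
    have hexp2 : Real.exp (π * |z.im|) ^ 2 = Real.exp (2 * π * |z.im|) := by
      rw [← Real.exp_nat_mul]; ring_nf
    calc 2 * ‖sincPi z‖ ^ 2 ≤ 2 * (Real.exp (π * |z.im|) / (π * ‖z‖)) ^ 2 := by gcongr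
      _ = (2 / π ^ 2) * (Real.exp (2 * π * |z.im|) / ‖z‖ ^ 2) := by
          rw [div_pow, mul_pow, hexp2]; field_simp
      _ ≤ 1 * (Real.exp (2 * π * |z.im|) / ‖z‖ ^ 2) := by
          gcongr
          rw [div_le_one (by positivity)]
          nlinarith [Real.pi_gt_three]
      _ = Real.exp (2 * π * |z.im|) / ‖z‖ ^ 2 := one_mul _
  calc ‖2 * sincPi z ^ 2 - (beurling (-z) - 1)‖ ≤ ‖2 * sincPi z ^ 2‖ + ‖beurling (-z) - 1‖ :=
        norm_sub_le _ _
    _ ≤ Real.exp (2 * π * |z.im|) / ‖z‖ ^ 2 + Real.exp (2 * π * |z.im|) / ‖z‖ ^ 2 := add_le_add h2 h1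
    _ = 2 * Real.exp (2 * π * |z.im|) / ‖z‖ ^ 2 := by ring

/-- `|B(z)| ≤ 3 e^{2π|Im z|}` for `|z| ≥ 1`. [cite: Vaaler1985, §1] -/
theorem norm_beurling_le_of_one_le_norm {z : ℂ} (hz1 : 1 ≤ ‖z‖) :
    ‖beurling z‖ ≤ 3 * Real.exp (2 * π * |z.im|) := by
  have hz0 : 0 < ‖z‖ := by linarith
  have he : 1 ≤ Real.exp (2 * π * |z.im|) := Real.one_le_exp (by positivity)
  have hdiv : Real.exp (2 * π * |z.im|) / ‖z‖ ^ 2 ≤ Real.exp (2 * π * |z.im|) := by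
    rw [div_le_iff₀ (by positivity)]
    have : 1 ≤ ‖z‖ ^ 2 := by nlinarith
    nlinarith [Real.exp_pos (2 * π * |z.im|)]
  rcases le_total 0 z.re with hz | hz
  · have h := norm_beurling_sub_one_le hz hz1
    calc ‖beurling z‖ = ‖(beurling z - 1) + 1‖ := by ring_nf
      _ ≤ ‖beurling z - 1‖ + ‖(1 : ℂ)‖ := norm_add_le _ _
      _ ≤ Real.exp (2 * π * |z.im|) + 1 := by rw [norm_one]; exact add_le_add (h.trans hdiv) le_rfl
      _ ≤ 3 * Real.exp (2 * π * |z.im|) := by linarith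
  · have h := norm_beurling_add_one_le hz hz1
    calc ‖beurling z‖ = ‖(beurling z + 1) - 1‖ := by ring_nf
      _ ≤ ‖beurling z + 1‖ + ‖(1 : ℂ)‖ := norm_sub_le _ _
      _ ≤ 2 * Real.exp (2 * π * |z.im|) + 1 := by
          rw [norm_one]
          refine add_le_add (h.trans ?_) le_rfl
          rw [mul_div_assoc]
          linarith
      _ ≤ 3 * Real.exp (2 * π * |z.im|) := by linarith

/-- **Exponential type `2π`: `|B(z)| ≤ 3e^{2π} · e^{2π|Im z|}` for all `z`** (maximum modulus
on the unit disc for `|z| ≤ 1`). [cite: Vaaler1985, §1] -/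
theorem norm_beurling_le (z : ℂ) :
    ‖beurling z‖ ≤ 3 * Real.exp (2 * π) * Real.exp (2 * π * |z.im|) := by
  have he : 1 ≤ Real.exp (2 * π * |z.im|) := Real.one_le_exp (by positivity)
  have he2 : 1 ≤ Real.exp (2 * π) := Real.one_le_exp (by positivity)
  rcases le_or_gt 1 ‖z‖ with hz | hz
  · calc ‖beurling z‖ ≤ 3 * Real.exp (2 * π * |z.im|) := norm_beurling_le_of_one_le_norm hz
      _ = 3 * 1 * Real.exp (2 * π * |z.im|) := by ring
      _ ≤ 3 * Real.exp (2 * π) * Real.exp (2 * π * |z.im|) := by gcongr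
  · have hmax : ‖beurling z‖ ≤ 3 * Real.exp (2 * π) := by
      refine Complex.norm_le_of_forall_mem_frontier_norm_le (f := beurling) (U := ball (0 : ℂ) 1)
        isBounded_ball differentiable_beurling.diffContOnCl ?_ ?_
      · intro w hw
        rw [frontier_ball (0 : ℂ) one_ne_zero, mem_sphere_zero_iff_norm] at hw
        have him : |w.im| ≤ 1 := hw ▸ Complex.abs_im_le_norm w
        calc ‖beurling w‖ ≤ 3 * Real.exp (2 * π * |w.im|) := norm_beurling_le_of_one_le_norm hw.ge
          _ ≤ 3 * Real.exp (2 * π) := by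
              apply mul_le_mul_of_nonneg_left _ (by norm_num)
              exact Real.exp_le_exp.2 (by nlinarith [Real.pi_pos, abs_nonneg w.im])
      · rw [closure_ball (0 : ℂ) one_ne_zero]
        exact mem_closedBall_zero_iff.2 hz.le
    calc ‖beurling z‖ ≤ 3 * Real.exp (2 * π) * 1 := by rw [mul_one]; exact hmax
      _ ≤ 3 * Real.exp (2 * π) * Real.exp (2 * π * |z.im|) := by gcongr

end Literature.Analysis.Fourier
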